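import Mathlib.Analysis.SpecialFunctions.Pow.Real

/-!
# Crux `AdiabaticMultiKerrILED` (line `Sketch`) — signs of the Morawetz bulk coefficients

Helper file for the crux `stmt-FinalStateConjecture-14310`
(`Summit.FinalStateConjecture.FinalStateConjecture.Theses.ClusterCompleteness.AdiabaticMultiKerrILED`),
line `Sketch`, stubs `morawetz_timeCoeff_nonneg`, `morawetz_radialCoeff_pos`,
`morawetz_angularCoeff_eq_inner`, `morawetz_angularCoeff_nonneg_outer` (lead c7, wave 4, Morawetz bricks).

For the zero-spin tails-cut zone (the static metric `g = −f dT² + dr²/f + r²dΩ²`,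
`f(s) = 1 − 2Mχ(s)/s`, `χ = Real.smoothTransition (2 − ·/(8M))`) the lead's degenerate Morawetz
multiplier is `X = F ∂_{r*}` with `F(s) = 1 − 3M/s`, together with the Lagrangian weight
`ϖ(s) = (1 − 2M/s)·((2s − 3M)/s² − M³(s − 3M)²/s⁶)` (built with the SCHWARZSCHILD factor
`1 − 2M/s`). The regrouped bulk is `A_T ψ₀² + A_R (∂_{r*}ψ)² + A_ang |∇̸ψ|² + P ψ²` with
`A_T = [f F_s + 2fF/s − ϖ]/(2f)`, `A_R = [f F_s − 2fF/s + ϖ]/(2f)`, `A_ang = ½[−F f_s − f F_s + ϖ]`,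
`f_s = 2Mχ/s² − 2Mχ′/s`. This file proves the four SIGN facts, with the value `χv ∈ [0, 1]` of `χ(s)`
and the slope `χd ∈ [−1/(4M), 0]` of `χ′(s)` abstracted as real parameters (pure real algebra):

* `morawetz_timeCoeff_nonneg`: `A_T ≥ 0` for `s > 2M`;
* `morawetz_radialCoeff_pos`: `A_R ≥ M/s²` for `s > 2M`;
* `morawetz_angularCoeff_eq_inner`: on the Schwarzschild region (`χ = 1`, `χ′ = 0`),
  `A_ang = (s − 3M)²(2s⁴ − M³s + 2M⁴)/(2s⁷)`;
* `morawetz_angularCoeff_nonneg_outer`: `A_ang ≥ 0` for `s ≥ 8M`.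

Proofs (Mathlib only): clear the positive denominators with `field_simp; ring` against an explicit
polynomial numerator, and certify the sign of that numerator as an explicit nonnegative combination
of products of the hypothesis gaps (`nlinarith` with the products supplied, or `positivity`).
[folklore]
-/

noncomputable section

-- the doubled `FinalStateConjecture.FinalStateConjecture` path component trips dupNamespace
set_option linter.dupNamespace false

namespace Summit.FinalStateConjecture.FinalStateConjecture.Theorems

/-- `6s⁴ − M(s − 2M)(s − 3M)² ≥ 0` for `0 < M`, `2M < s`: indeed it equals
`(11/2)s⁴ + (1/2)(s − 2M)s³ + 2M²s² + 3M²(s − 2M)(2s − 3M)`, a sum of nonnegative terms. [folklore] -/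
private theorem morawetz_radialPoly₀_nonneg {M s : ℝ} (hM : 0 < M) (hsM : 2 * M < s) :
    0 ≤ 6 * s ^ 4 - M * (s - 2 * M) * (s - 3 * M) ^ 2 := by
  have hs : 0 < s := by linarith
  have h2 : 0 ≤ s - 2 * M := by linarith
  have h3 : 0 ≤ 2 * s - 3 * M := by linarith
  nlinarith [pow_nonneg hs.le 4, mul_nonneg h2 (pow_nonneg hs.le 3), sq_nonneg (M * s),
    mul_nonneg (mul_nonneg (sq_nonneg M) h2) h3]

/-- `4s⁴ − M²(s − 3M)² ≥ 0` for `0 < M`, `2M < s`: indeed it equals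
`(15/4)s⁴ + (1/4)(s − 2M)(s + 2M)s² + 3M³(2s − 3M)`, a sum of nonnegative terms. [folklore] -/
private theorem morawetz_radialPoly₁_nonneg {M s : ℝ} (hM : 0 < M) (hsM : 2 * M < s) :
    0 ≤ 4 * s ^ 4 - M ^ 2 * (s - 3 * M) ^ 2 := by
  have hs : 0 < s := by linarith
  have h2 : 0 ≤ s - 2 * M := by linarith
  have h2' : 0 ≤ s + 2 * M := by linarith
  have h3 : 0 ≤ 2 * s - 3 * M := by linarith
  nlinarith [pow_nonneg hs.le 4, mul_nonneg (mul_nonneg h2 h2') (sq_nonneg s),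
    mul_nonneg (pow_nonneg hM.le 3) h3]

/-- The cleared numerator of `A_R − M/s²`,
`P = (s − 2Mχv)(7M − 2s)s⁴ + (s − 2M)(2s − 3M)s⁴ − (s − 2M)M³(s − 3M)²`, is nonnegative for
`0 < M`, `2M < s`, `0 ≤ χv ≤ 1`: it is AFFINE in `χv`, namely
`P = (1 − χv)·M²·(6s⁴ − M(s − 2M)(s − 3M)²) + χv·(s − 2M)M·(4s⁴ − M²(s − 3M)²)`,
and both endpoint values are nonnegative. [folklore] -/
private theorem morawetz_radialPoly_nonneg {M s χv : ℝ} (hM : 0 < M) (hsM : 2 * M < s)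
    (hχ0 : 0 ≤ χv) (hχ1 : χv ≤ 1) :
    0 ≤ (s - 2 * M * χv) * (7 * M - 2 * s) * s ^ 4 + (s - 2 * M) * (2 * s - 3 * M) * s ^ 4 -
      (s - 2 * M) * M ^ 3 * (s - 3 * M) ^ 2 := by
  have h2 : 0 ≤ s - 2 * M := by linarith
  have h1 : 0 ≤ 1 - χv := by linarith
  nlinarith [mul_nonneg h1 (mul_nonneg (sq_nonneg M) (morawetz_radialPoly₀_nonneg hM hsM)),
    mul_nonneg hχ0 (mul_nonneg (mul_nonneg h2 hM.le) (morawetz_radialPoly₁_nonneg hM hsM))]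

/-- `3(s − 4M)s⁴ − 2(s − 2M)M³(s − 3M) ≥ 0` for `0 < M`, `8M ≤ s`: it equals
`(3/2)(s − 8M)s⁴ + (383/256)s⁵ + (1/256)s²(s − 8M)(s² + 8Ms + 64M²) + 2M⁴(5s − 6M)`,
a sum of nonnegative terms. [folklore] -/
private theorem morawetz_angularPoly_nonneg {M s : ℝ} (hM : 0 < M) (hsM : 8 * M ≤ s) :
    0 ≤ 3 * (s - 4 * M) * s ^ 4 - 2 * (s - 2 * M) * M ^ 3 * (s - 3 * M) := by
  have hs : 0 < s := by linarith
  have h8 : 0 ≤ s - 8 * M := by linarith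
  have h56 : 0 ≤ 5 * s - 6 * M := by linarith
  have hq : 0 ≤ s ^ 2 + 8 * M * s + 64 * M ^ 2 := by positivity
  nlinarith [mul_nonneg h8 (pow_nonneg hs.le 4), pow_nonneg hs.le 5,
    mul_nonneg (mul_nonneg (sq_nonneg s) h8) hq, mul_nonneg (pow_nonneg hM.le 4) h56]

/-- **Stub `morawetz_timeCoeff_nonneg`** (crux `AdiabaticMultiKerrILED`, line `Sketch`). The time
coefficient `A_T = [f F_s + 2fF/s − ϖ]/(2f)` of the regrouped Morawetz bulk (`F = 1 − 3M/s`,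
`f = 1 − 2Mχv/s`, `ϖ(s) = (1 − 2M/s)((2s − 3M)/s² − M³(s − 3M)²/s⁶)`) is nonnegative for
`s > 2M`, `χv ∈ [0, 1]`: its numerator is
`(f − f_S)(2s − 3M)/s² + f_S M³(s − 3M)²/s⁶ = [2M(1 − χv)(2s − 3M)s⁴ + (s − 2M)M³(s − 3M)²]/s⁷ ≥ 0`
(`f_S = 1 − 2M/s`), and `f > 0`. [folklore] -/
theorem morawetz_timeCoeff_nonneg : ∀ (M s χv : ℝ), 0 < M → 2 * M < s → 0 ≤ χv → χv ≤ 1 → 0 ≤ ((1 - 2 * M * χv / s) * (3 * M / s ^ 2) + 2 * (1 - 2 * M * χv / s) * (1 - 3 * M / s) / s - (fun s : ℝ ↦ (1 - 2 * M / s) * ((2 * s - 3 * M) / s ^ 2 - M ^ 3 * (s - 3 * M) ^ 2 / s ^ 6)) s) / (2 * (1 - 2 * M * χv / s)) := by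
  intro M s χv hM hsM hχ0 hχ1
  beta_reduce
  have hs : 0 < s := by linarith
  have hχs : 2 * M * χv < s := by nlinarith [mul_le_mul_of_nonneg_left hχ1 hM.le]
  have hf : 0 < 1 - 2 * M * χv / s := by
    rw [sub_pos, div_lt_one hs]
    exact hχs
  refine div_nonneg ?_ (by linarith)
  have key : (1 - 2 * M * χv / s) * (3 * M / s ^ 2) +
      2 * (1 - 2 * M * χv / s) * (1 - 3 * M / s) / s -
      (1 - 2 * M / s) * ((2 * s - 3 * M) / s ^ 2 - M ^ 3 * (s - 3 * M) ^ 2 / s ^ 6) =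
      (2 * M * (1 - χv) * (2 * s - 3 * M) * s ^ 4 + (s - 2 * M) * M ^ 3 * (s - 3 * M) ^ 2) /
        s ^ 7 := by
    field_simp
    ring
  rw [key]
  have h1 : 0 ≤ 1 - χv := by linarith
  have h2 : 0 ≤ 2 * s - 3 * M := by linarith
  have h3 : 0 ≤ s - 2 * M := by linarith
  positivity

/-- **Stub `morawetz_radialCoeff_pos`** (crux `AdiabaticMultiKerrILED`, line `Sketch`). The radial
coefficient `A_R = [f F_s − 2fF/s + ϖ]/(2f)` of the regrouped Morawetz bulk (`F = 1 − 3M/s`,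
`f = 1 − 2Mχv/s`, `ϖ(s) = (1 − 2M/s)((2s − 3M)/s² − M³(s − 3M)²/s⁶)`) satisfies `A_R ≥ M/s²` for
`s > 2M`, `χv ∈ [0, 1]`: `A_R − M/s² = P/(2(s − 2Mχv)s⁶)` with the polynomial `P` of
`morawetz_radialPoly_nonneg`, affine in `χv` and nonnegative at both endpoints. [folklore] -/
theorem morawetz_radialCoeff_pos : ∀ (M s χv : ℝ), 0 < M → 2 * M < s → 0 ≤ χv → χv ≤ 1 → M / s ^ 2 ≤ ((1 - 2 * M * χv / s) * (3 * M / s ^ 2) - 2 * (1 - 2 * M * χv / s) * (1 - 3 * M / s) / s + (fun s : ℝ ↦ (1 - 2 * M / s) * ((2 * s - 3 * M) / s ^ 2 - M ^ 3 * (s - 3 * M) ^ 2 / s ^ 6)) s) / (2 * (1 - 2 * M * χv / s)) := by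
  intro M s χv hM hsM hχ0 hχ1
  beta_reduce
  have hs : 0 < s := by linarith
  have hχs : 2 * M * χv < s := by nlinarith [mul_le_mul_of_nonneg_left hχ1 hM.le]
  have hden : 0 < s - 2 * M * χv := by linarith
  have hden' : s - 2 * M * χv ≠ 0 := hden.ne'
  have hf : 0 < 1 - 2 * M * χv / s := by
    rw [sub_pos, div_lt_one hs]
    exact hχs
  have hf' : 1 - 2 * M * χv / s ≠ 0 := hf.ne'
  rw [← sub_nonneg]
  have key : ((1 - 2 * M * χv / s) * (3 * M / s ^ 2) -
      2 * (1 - 2 * M * χv / s) * (1 - 3 * M / s) / s +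
      (1 - 2 * M / s) * ((2 * s - 3 * M) / s ^ 2 - M ^ 3 * (s - 3 * M) ^ 2 / s ^ 6)) /
      (2 * (1 - 2 * M * χv / s)) - M / s ^ 2 =
      ((s - 2 * M * χv) * (7 * M - 2 * s) * s ^ 4 + (s - 2 * M) * (2 * s - 3 * M) * s ^ 4 -
        (s - 2 * M) * M ^ 3 * (s - 3 * M) ^ 2) / (2 * (s - 2 * M * χv) * s ^ 6) := by
    field_simp
    ring
  rw [key]
  have hP := morawetz_radialPoly_nonneg hM hsM hχ0 hχ1
  positivity

/-- **Stub `morawetz_angularCoeff_eq_inner`** (crux `AdiabaticMultiKerrILED`, line `Sketch`). On the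
Schwarzschild region (`χ = 1`, `χ′ = 0`, so `f = 1 − 2M/s`, `f_s = 2M/s²`) the angular coefficient
`A_ang = ½[−F f_s − f F_s + ϖ]` of the regrouped Morawetz bulk factors as
`(s − 3M)²(2s⁴ − M³s + 2M⁴)/(2s⁷)` — it vanishes to second order exactly at the photon sphere
`s = 3M`. Pure rational identity. [folklore] -/
theorem morawetz_angularCoeff_eq_inner : ∀ (M s : ℝ), 0 < M → 0 < s → 2⁻¹ * (-(1 - 3 * M / s) * (2 * M / s ^ 2) - (1 - 2 * M / s) * (3 * M / s ^ 2) + (fun s : ℝ ↦ (1 - 2 * M / s) * ((2 * s - 3 * M) / s ^ 2 - M ^ 3 * (s - 3 * M) ^ 2 / s ^ 6)) s) = (s - 3 * M) ^ 2 * (2 * s ^ 4 - M ^ 3 * s + 2 * M ^ 4) / (2 * s ^ 7) := by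
  intro M s _hM hs
  beta_reduce
  rw [eq_div_iff (by positivity)]
  field_simp
  ring

/-- **Stub `morawetz_angularCoeff_nonneg_outer`** (crux `AdiabaticMultiKerrILED`, line `Sketch`).
The angular coefficient `A_ang = ½[−F f_s − f F_s + ϖ]` of the regrouped Morawetz bulk
(`F = 1 − 3M/s`, `f = 1 − 2Mχv/s`, `f_s = 2Mχv/s² − 2Mχd/s`) is nonnegative for `s ≥ 8M` whenever
`χv ∈ [0, 1]` and `χd ∈ [−1/(4M), 0]`: `2s⁷·(2A_ang)` equals
`(s − 3M)·[3(s − 4M)s⁴ − 2(s − 2M)M³(s − 3M)] + 4Ms⁴(s − 6M)(1 − χv) + s⁵(s − 3M)(4Mχd + 1)`,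
each summand nonnegative (the bracket by `morawetz_angularPoly_nonneg`). [folklore] -/
theorem morawetz_angularCoeff_nonneg_outer : ∀ (M s χv χd : ℝ), 0 < M → 8 * M ≤ s → 0 ≤ χv → χv ≤ 1 → -(1 / (4 * M)) ≤ χd → χd ≤ 0 → 0 ≤ 2⁻¹ * (-(1 - 3 * M / s) * (2 * M * χv / s ^ 2 - 2 * M * χd / s) - (1 - 2 * M * χv / s) * (3 * M / s ^ 2) + (fun s : ℝ ↦ (1 - 2 * M / s) * ((2 * s - 3 * M) / s ^ 2 - M ^ 3 * (s - 3 * M) ^ 2 / s ^ 6)) s) := by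
  intro M s χv χd hM hsM _hχ0 hχ1 hd0 _hd1
  beta_reduce
  have hs : 0 < s := by linarith
  have hd : 0 ≤ 4 * M * χd + 1 := by
    have h4M : (0 : ℝ) < 4 * M := by positivity
    rw [neg_le, le_div_iff₀ h4M] at hd0
    linarith
  have h3 : 0 ≤ s - 3 * M := by linarith
  have h6 : 0 ≤ s - 6 * M := by linarith
  have h1 : 0 ≤ 1 - χv := by linarith
  have hQ : 0 ≤ 3 * (s - 3 * M) * (s - 4 * M) * s ^ 4 - 2 * (s - 2 * M) * M ^ 3 * (s - 3 * M) ^ 2 +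
      4 * M * s ^ 4 * (s - 6 * M) * (1 - χv) + s ^ 5 * (s - 3 * M) * (4 * M * χd + 1) := by
    nlinarith [mul_nonneg h3 (morawetz_angularPoly_nonneg hM hsM),
      mul_nonneg (mul_nonneg (mul_nonneg hM.le (pow_nonneg hs.le 4)) h6) h1,
      mul_nonneg (mul_nonneg (pow_nonneg hs.le 5) h3) hd]
  have key : -(1 - 3 * M / s) * (2 * M * χv / s ^ 2 - 2 * M * χd / s) -
      (1 - 2 * M * χv / s) * (3 * M / s ^ 2) +
      (1 - 2 * M / s) * ((2 * s - 3 * M) / s ^ 2 - M ^ 3 * (s - 3 * M) ^ 2 / s ^ 6) =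
      (3 * (s - 3 * M) * (s - 4 * M) * s ^ 4 - 2 * (s - 2 * M) * M ^ 3 * (s - 3 * M) ^ 2 +
        4 * M * s ^ 4 * (s - 6 * M) * (1 - χv) + s ^ 5 * (s - 3 * M) * (4 * M * χd + 1)) /
        (2 * s ^ 7) := by
    field_simp
    ring
  rw [key]
  positivity

end Summit.FinalStateConjecture.FinalStateConjecture.Theorems

end
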